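import Summits.ValiantsHypothesis.ValiantsHypothesis.Theorems.NewtonUnitEquationsTwoProductsRankOneThreeGenLawShiftPlanar
import HarnessLib

/-!
# Route NewtonUnitEquations — crux `TwoProducts` (stmt-ValiantsHypothesis-5906), line `relation_ladder`, rung R8 (ONE-SIDED rank one
# `p•α = Σ_i q_i•β_i`, any number of plus letters): the DILATED FREE LIFT with a plus-letter SET — part 1/6 — one-sided index data `OIdx`, the dilated free substitution `frM`, reduced exponents, fibres with divisibility guards (T2–T3)

Part 1: `OIdx` (lone index `a`, coefficient `p ≥ 1`, plus coefficients `qf` with `qf a = 0`, `qf ≢ 0`), `B = {qf ≠ 0}`, `rest`, the substitution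
`frM` and its coordinates (`piT_frM_a/B/other`), `xhat`, `Lof`, admissibility `Adm`/`KR`, `eq_Lof_of_piT`, `piT_Lof`, degrees, `Bk`, `Bk_le`, `Bk_pos`.

THE ONE-SIDED RANK-ONE LAW `p•α = Σ_{i<k} q_i•β_i` (R8; all `p, q_i ≥ 1`, distinct letters, every additive coincidence of the letter
family a multiple of this one relation): GLOBALLY `#visible ≤ 2^{c m}(#T + 2)^c` (`c = 1732`).  Engine (val-idea-8 g3's memo
`Cruxes/TwoProducts/Lines/relation_ladder_R8_engine.md` rev 2, typed target `Lines/relation_ladder_sketch_R8.lean :: R8.RankOneOneSidedLaw`,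
slice count `Lines/relation_ladder_R8_simplex.lean` = landed `…RankOneSimplexCount`): the DILATED FREE LIFT `α ↦ ∏ Y_j^{q_j}`, `Y_j ↦ Y_j^p` on
the plus letters, identity elsewhere, over the `p`-dilated plane (`enumP : j ↦ enum j` on the plus letters, `i ↦ p•enum i` otherwise); fibres
`k = #α` with divisibility guards `p ∣ x_j − q_j k`; letter count `B_k = k + Σ_j (x_j − q_j k)/p`; SLICING by the whole plus-letter exponent
vector `b = x|_B`; the coefficient theorem with `Pfac · C(R + B_k − 1, B_k) · κ_k`; finite SHIFT RANK `2m(Σb + 1)² + 1` and val-lit-p3's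
`ShiftRank.pencilCount` BY NAME; the slices of the visible points factor through the restricted letter multisets `L₀|_{a ∪ B}` (`deg L₀ ≤ m`),
counted by the simplex bound `#W ≤ 2^{n+k}` (`R8.card_W_le`); WIDE plus sides (`k > m + 1`), large (`> m`) or absent coefficients/letters are
permutation type (R3♯).  `k = 1` is R7c (`R7b.rankOneTwoLaw_proof`), `k = 2` is R7b (`R7b.rankOneThreeGenLaw_proof`).

AUTHORSHIP / LANE NOTE (val-lit-p3 g15, prover seat, helper mode `--supports stmt-ValiantsHypothesis-5906 --as helper`; CLAIM-FIRST #2 on the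
val-lit bus 12:55Z, silence = GO 13:30Z, no objection; the line owner val-idea-8 g3 CLOSED 12:24Z leaving R8 as a typed target + memo): part 1/6.
The STATEMENT is val-idea-8 g3's typed `R8.RankOneOneSidedLaw` (landed here by its LITERAL BODY, `OneSidedRankOne` unfolded — parameter-free
`def … : Prop` are not declared in Theorems files); the engine follows g3's memo decl-by-decl as a generalisation of the landed R7b REV 2 port
(`…RankOneThreeGenLaw*`, namespace `R7b`); the Lean text of this module is this seat's.  Reused BY NAME: `R6b.HSD` (+ closure lemmas),
`R7b.dilE`/`R7b.piT_dilE`/`R7b.piE_dilE`, `R7a.permType_of_rankOne_largeCoeff/absent`, `toolBound_mono`, `tab`, `sgn`, `R6b.sum_sgn`,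
`PlanarCell.eq_of_nsmul_eq`, `FormalLogLinearisation.wt_nsmul`, `R8.card_W_le` (simplex).  Namespace `…PermutationType.R8` (the typed target's).
Nothing here closes the line's residual (`ResidualLawV20`), the crux `TwoProducts` (5906) or `VP ≠ VNP`; no summit statement is proved.

Honest scope: TWO-SIDED relations with ≥ 2 letters on each side (e.g. `α+2β = γ+δ`, val-neg-1 g4's p635912) and coincidence rank ≥ 2 are NOT
covered.  Nothing here moves VP ≠ VNP; `TwoProducts` (5906) / `PlanarCellBound` stay OPEN. [folklore]

Cut table (this seat's scratch `HOME/lmr/staged/p3g15-R8/R8-Scratch.lean`, 1 798 lines, rc 0 / 0 warnings / 0 sorries): part 1 `…Free`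
= T2–T3 (`OIdx`, `frM`, `xhat`, `Lof`, `Adm`/`KR`, `Bk`; bookkeeping choice, the only deviation from the memo: the plus side is a coefficient FUNCTION
`qf : σ → ℕ` with `B = {qf ≠ 0}`, no `Fin k` families inside the engine — the typed `(β, q) : Fin k → …` data are met only in the law); part 2 `…Slice` = `Pfac`, `kap`, `multinomial_Lof_eq`, `coeff_phiT_frM`, T4 slice
functions and THE COEFFICIENT THEOREM `coeff_free_logTrunc`; part 3 `…SliceExc` = the exceptional point, `mem_support_free_logTrunc_iff`,
`xOf`, `Fsl_congr`; part 4 `…ShiftPlanar` = T5 `Fsl_shift` + T7 `RelDataO`, `enumP`, injectivity, lifted visible points, letter weights;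
part 5 `…Count` = T8 `sliceMin_of_visible`, `card_le_of_supported`, `sliceCount`, `RelDataO.count`; part 6 `…Law` = wide ⇒ permutation type,
arithmetic (`c = 1732`), `rankOneOneSidedLaw_proof`.
-/

noncomputable section

-- Sub = Summit single-conjunct layout: the duplicated namespace component is mandated by the tree.
set_option linter.dupNamespace false
set_option linter.unusedSimpArgs false
set_option linter.unusedSectionVars false
set_option linter.unusedVariables false

namespace Summit.ValiantsHypothesis.ValiantsHypothesis.Theorems.NewtonUnitEquations.TwoProducts.PermutationType
namespace R8
open scoped BigOperators
open MvPolynomial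

variable {σ : Type*} [Fintype σ] [DecidableEq σ]

/-! ## Part T2: one-sided relation data `p•α = Σ_j qf j • e_j` and the dilated free substitution -/

/-- One-sided relation data on an index type: the lone letter `a` (coefficient `p ≥ 1`) and the plus-side coefficient function `qf`
(`qf a = 0`, at least one nonzero value). [folklore] -/
structure OIdx (σ : Type*) where
  /-- index of the lone letter `α` (idle upstairs) -/
  a : σ
  /-- plus-side coefficients (`0` off the plus letters) -/
  qf : σ → ℕ
  /-- coefficient of `α` -/
  p : ℕ
  hp : 1 ≤ p
  hqa : qf a = 0
  hne : ∃ j, qf j ≠ 0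

variable (Io : OIdx σ)

/-- The plus letters `B = {j | qf j ≠ 0}`. [folklore] -/
def B : Finset σ := Finset.univ.filter fun j => Io.qf j ≠ 0

/-- Membership in the plus letters. [folklore] -/
theorem mem_B (j : σ) : j ∈ B Io ↔ Io.qf j ≠ 0 := by
  unfold B; simp

/-- The lone letter is not a plus letter. [folklore] -/
theorem a_notMem_B : Io.a ∉ B Io := by
  rw [mem_B]; exact fun h => h Io.hqa

/-- A plus letter is not the lone letter. [folklore] -/
theorem ne_a_of_mem_B {j : σ} (hj : j ∈ B Io) : j ≠ Io.a := by
  rintro rfl; exact a_notMem_B Io hj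

/-- The plus side is nonempty. [folklore] -/
theorem B_nonempty : (B Io).Nonempty := by
  obtain ⟨j, hj⟩ := Io.hne; exact ⟨j, (mem_B Io j).2 hj⟩

/-- The substitution on letters: `α ↦ Σ_j qf j • e_j`, `j ↦ p e_j` on plus letters, identity elsewhere. [folklore] -/
def frM (i : σ) : σ →₀ ℕ :=
  if i = Io.a then ofFun Io.qf else if Io.qf i ≠ 0 then Finsupp.single i Io.p else Finsupp.single i 1

/-- The substitution at the lone letter. [folklore] -/
theorem frM_a : frM Io Io.a = ofFun Io.qf := by
  unfold frM; rw [if_pos rfl]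

/-- The substitution at a plus letter. [folklore] -/
theorem frM_B {j : σ} (hj : j ∈ B Io) : frM Io j = Finsupp.single j Io.p := by
  unfold frM; rw [if_neg (ne_a_of_mem_B Io hj), if_pos ((mem_B Io j).1 hj)]

/-- The substitution elsewhere. [folklore] -/
theorem frM_other {j : σ} (ha : j ≠ Io.a) (hj : Io.qf j = 0) : frM Io j = Finsupp.single j 1 := by
  unfold frM; rw [if_neg ha, if_neg (by simpa using hj)]

/-- Every `frM i` is nonzero. [folklore] -/
theorem frM_ne_zero (i : σ) : frM Io i ≠ 0 := by
  have hp := Io.hp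
  by_cases hia : i = Io.a
  · subst hia
    rw [frM_a]
    obtain ⟨j, hj⟩ := Io.hne
    intro h
    have := DFunLike.congr_fun h j
    simp at this
    exact hj this
  by_cases hq : Io.qf i ≠ 0
  · rw [frM_B Io ((mem_B Io i).2 hq)]
    intro h; have := DFunLike.congr_fun h i; simp at this; omega
  · push Not at hq
    rw [frM_other Io hia hq]
    intro h; have := DFunLike.congr_fun h i; simp at this

/-- Value of `frM i` at the lone letter: always `0`. [folklore] -/
theorem frM_apply_a (i : σ) : frM Io i Io.a = 0 := by
  by_cases hia : i = Io.a
  · subst hia; rw [frM_a]; simp [Io.hqa]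
  by_cases hq : Io.qf i ≠ 0
  · rw [frM_B Io ((mem_B Io i).2 hq), Finsupp.single_apply, if_neg hia]
  · push Not at hq
    rw [frM_other Io hia hq, Finsupp.single_apply, if_neg hia]

/-- Value of `frM i` at a plus letter `j`: `qf j` from the lone letter, `p` from `j` itself, `0` otherwise. [folklore] -/
theorem frM_apply_B {j : σ} (hj : j ∈ B Io) (i : σ) :
    frM Io i j = (if i = Io.a then Io.qf j else 0) + (if i = j then Io.p else 0) := by
  have hja := ne_a_of_mem_B Io hj
  by_cases hia : i = Io.a
  · subst hia; rw [frM_a, if_pos rfl, if_neg hja.symm]; simp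
  rw [if_neg hia, zero_add]
  by_cases hq : Io.qf i ≠ 0
  · rw [frM_B Io ((mem_B Io i).2 hq), Finsupp.single_apply]
  · push Not at hq
    have hij : i ≠ j := fun h => by rw [h] at hq; exact ((mem_B Io j).1 hj) hq
    rw [frM_other Io hia hq, Finsupp.single_apply, if_neg hij, if_neg hij]

/-- Value of `frM i` at a rest letter `j` (`j ≠ a`, `qf j = 0`): the indicator of `i = j`. [folklore] -/
theorem frM_apply_other {j : σ} (hja : j ≠ Io.a) (hjq : Io.qf j = 0) (i : σ) :
    frM Io i j = if i = j then 1 else 0 := by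
  by_cases hia : i = Io.a
  · subst hia; rw [frM_a, if_neg hja.symm]; simp [hjq]
  by_cases hq : Io.qf i ≠ 0
  · have hij : i ≠ j := fun h => by rw [h] at hq; exact hq hjq
    rw [frM_B Io ((mem_B Io i).2 hq), Finsupp.single_apply, if_neg hij, if_neg hij]
  · push Not at hq
    rw [frM_other Io hia hq, Finsupp.single_apply]

/-- The `a`-coordinate of a toric image vanishes. [folklore] -/
theorem piT_frM_a (L : σ →₀ ℕ) : piT (frM Io) L Io.a = 0 := by
  rw [piT_apply]
  exact Finset.sum_eq_zero fun i _ => by rw [frM_apply_a, mul_zero]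

/-- A plus coordinate of a toric image: `qf j · #α + p · #j`. [folklore] -/
theorem piT_frM_B (L : σ →₀ ℕ) {j : σ} (hj : j ∈ B Io) : piT (frM Io) L j = Io.qf j * L Io.a + Io.p * L j := by
  rw [piT_apply]
  simp only [frM_apply_B Io hj, mul_add, Finset.sum_add_distrib, mul_ite, mul_zero, Finset.sum_ite_eq', Finset.mem_univ,
    if_true]
  ring

/-- Other coordinates of a toric image are unchanged. [folklore] -/
theorem piT_frM_other (L : σ →₀ ℕ) {j : σ} (hja : j ≠ Io.a) (hjq : Io.qf j = 0) : piT (frM Io) L j = L j := by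
  rw [piT_apply]
  simp only [frM_apply_other Io hja hjq, mul_ite, mul_one, mul_zero, Finset.sum_ite_eq', Finset.mem_univ, if_true]

/-! ## Part T3: reduced exponents, fibres with divisibility guards, degrees, the multinomial regrouping -/

/-- The remaining indices (neither the lone letter nor a plus letter). [folklore] -/
def rest : Finset σ := Finset.univ \ insert Io.a (B Io)

/-- Membership in the remaining indices. [folklore] -/
theorem mem_rest (j : σ) : j ∈ rest Io ↔ j ≠ Io.a ∧ Io.qf j = 0 := by
  unfold rest
  rw [Finset.mem_sdiff, Finset.mem_insert, mem_B]
  constructor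
  · intro h; push Not at h; exact ⟨h.2.1, h.2.2⟩
  · intro h; exact ⟨Finset.mem_univ _, by push Not; exact ⟨h.1, h.2⟩⟩

/-- Splitting a product over `σ` into rest × lone letter × plus letters. [folklore] -/
theorem prod_split {β : Type*} [CommMonoid β] (f : σ → β) :
    ∏ j, f j = (∏ j ∈ rest Io, f j) * (f Io.a * ∏ j ∈ B Io, f j) := by
  unfold rest
  rw [← Finset.prod_sdiff (Finset.subset_univ (insert Io.a (B Io))), Finset.prod_insert (a_notMem_B Io)]

/-- Splitting a sum over `σ` into rest + lone letter + plus letters. [folklore] -/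
theorem sum_split {β : Type*} [AddCommMonoid β] (f : σ → β) :
    ∑ j, f j = (∑ j ∈ rest Io, f j) + (f Io.a + ∑ j ∈ B Io, f j) := by
  unfold rest
  rw [← Finset.sum_sdiff (Finset.subset_univ (insert Io.a (B Io))), Finset.sum_insert (a_notMem_B Io)]

/-- The reduced exponent `x̂`: the lone letter and the plus letters set to zero. [folklore] -/
def xhat (x : σ →₀ ℕ) : σ →₀ ℕ := ofFun fun j => if j = Io.a ∨ Io.qf j ≠ 0 then 0 else x j

/-- The reduced exponent at the lone letter. [folklore] -/
theorem xhat_a (x : σ →₀ ℕ) : xhat Io x Io.a = 0 := by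
  simp [xhat]

/-- The reduced exponent at a plus letter. [folklore] -/
theorem xhat_B (x : σ →₀ ℕ) {j : σ} (hj : j ∈ B Io) : xhat Io x j = 0 := by
  rw [mem_B] at hj; simp [xhat, hj]

/-- The reduced exponent at a rest letter. [folklore] -/
theorem xhat_rest (x : σ →₀ ℕ) {j : σ} (hj : j ∈ rest Io) : xhat Io x j = x j := by
  rw [mem_rest] at hj; simp [xhat, hj.1, hj.2]

/-- The letter multiset in the fibre over `x` with `#α = k`: `#j = (x j - qf j · k) / p` at the plus letters. [folklore] -/
def Lof (x : σ →₀ ℕ) (k : ℕ) : σ →₀ ℕ :=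
  ofFun fun j => if j = Io.a then k else if Io.qf j ≠ 0 then (x j - Io.qf j * k) / Io.p else x j

/-- The fibre element at the lone letter. [folklore] -/
theorem Lof_a (x : σ →₀ ℕ) (k : ℕ) : Lof Io x k Io.a = k := by
  simp [Lof]

/-- The fibre element at a plus letter. [folklore] -/
theorem Lof_B (x : σ →₀ ℕ) (k : ℕ) {j : σ} (hj : j ∈ B Io) : Lof Io x k j = (x j - Io.qf j * k) / Io.p := by
  have hja := ne_a_of_mem_B Io hj
  rw [mem_B] at hj; simp [Lof, hja, hj]

/-- The fibre element at a rest letter. [folklore] -/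
theorem Lof_rest (x : σ →₀ ℕ) (k : ℕ) {j : σ} (hj : j ∈ rest Io) : Lof Io x k j = x j := by
  rw [mem_rest] at hj; simp [Lof, hj.1, hj.2]

/-- Admissibility of `k = #α` for the slice vector `b` (the exponent on the plus letters): `qf j · k ≤ b j` and
`p ∣ b j - qf j · k` at every plus letter. [folklore] -/
abbrev Adm (b : σ → ℕ) (k : ℕ) : Prop := ∀ j ∈ B Io, Io.qf j * k ≤ b j ∧ Io.p ∣ b j - Io.qf j * k

/-- An admissible `k` is at most the total slice mass `Σ_{j ∈ B} b j`. [folklore] -/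
theorem le_sum_of_adm {b : σ → ℕ} {k : ℕ} (hk : Adm Io b k) : k ≤ ∑ j ∈ B Io, b j := by
  obtain ⟨j₀, hj₀⟩ := B_nonempty Io
  have h1 : 1 ≤ Io.qf j₀ := Nat.one_le_iff_ne_zero.mpr ((mem_B Io j₀).1 hj₀)
  have h2 := (hk j₀ hj₀).1
  calc k ≤ Io.qf j₀ * k := Nat.le_mul_of_pos_left k h1
    _ ≤ b j₀ := h2
    _ ≤ ∑ j ∈ B Io, b j := Finset.single_le_sum (fun j _ => Nat.zero_le (b j)) hj₀

/-- The admissible range of `k = #α` in the fibre over `x`. [folklore] -/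
def KR (x : σ →₀ ℕ) : Finset ℕ := (Finset.range (∑ j ∈ B Io, x j + 1)).filter fun k => Adm Io x k

/-- Membership in the admissible range. [folklore] -/
theorem mem_KR (x : σ →₀ ℕ) (k : ℕ) : k ∈ KR Io x ↔ Adm Io x k := by
  unfold KR
  rw [Finset.mem_filter, Finset.mem_range]
  constructor
  · exact fun h => h.2
  · intro h; exact ⟨Nat.lt_succ_of_le (le_sum_of_adm Io h), h⟩

/-- (F1) Every preimage of `x` is an `Lof x k` with `k` admissible (and `x a = 0`). [folklore] -/
theorem eq_Lof_of_piT (L x : σ →₀ ℕ) (h : piT (frM Io) L = x) :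
    x Io.a = 0 ∧ L Io.a ∈ KR Io x ∧ L = Lof Io x (L Io.a) := by
  have ha := piT_frM_a Io L
  rw [h] at ha
  have hB : ∀ j ∈ B Io, x j = Io.qf j * L Io.a + Io.p * L j := fun j hj => by rw [← h, piT_frM_B Io L hj]
  refine ⟨ha, (mem_KR Io x _).2 fun j hj => ⟨by rw [hB j hj]; omega, ⟨L j, by rw [hB j hj]; omega⟩⟩, ?_⟩
  ext j
  by_cases hja : j = Io.a
  · subst hja; rw [Lof_a]
  by_cases hjB : j ∈ B Io
  · rw [Lof_B Io x _ hjB, hB j hjB, show Io.qf j * L Io.a + Io.p * L j - Io.qf j * L Io.a = Io.p * L j by omega,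
      Nat.mul_div_cancel_left _ Io.hp]
  · have hjr : j ∈ rest Io := (mem_rest Io j).2 ⟨hja, by rw [mem_B] at hjB; push Not at hjB; exact hjB⟩
    rw [Lof_rest Io x _ hjr, ← h, piT_frM_other Io L hja ((mem_rest Io j).1 hjr).2]

/-- (F2) Every admissible `Lof x k` lies in the fibre over `x` (when `x a = 0`). [folklore] -/
theorem piT_Lof (x : σ →₀ ℕ) (hx : x Io.a = 0) (k : ℕ) (hk : k ∈ KR Io x) : piT (frM Io) (Lof Io x k) = x := by
  rw [mem_KR] at hk
  ext j
  by_cases hja : j = Io.a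
  · subst hja; rw [piT_frM_a, hx]
  by_cases hjB : j ∈ B Io
  · obtain ⟨h1, h2⟩ := hk j hjB
    rw [piT_frM_B Io _ hjB, Lof_a, Lof_B Io x k hjB, Nat.mul_div_cancel' h2]; omega
  · have hjq : Io.qf j = 0 := by rw [mem_B] at hjB; push Not at hjB; exact hjB
    rw [piT_frM_other Io _ hja hjq, Lof_rest Io x k ((mem_rest Io j).2 ⟨hja, hjq⟩)]

/-- The degree of the reduced exponent: `R = Σ_{rest} x_j`. [folklore] -/
theorem deg_xhat (x : σ →₀ ℕ) : deg (xhat Io x) = ∑ j ∈ rest Io, x j := by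
  rw [deg_eq_sum, sum_split Io, xhat_a, Finset.sum_eq_zero (fun j hj => xhat_B Io x hj), zero_add, add_zero]
  exact Finset.sum_congr rfl fun j hj => xhat_rest Io x hj

/-- The full degree in terms of the reduced one. [folklore] -/
theorem deg_eq_deg_xhat_add (x : σ →₀ ℕ) : deg x = deg (xhat Io x) + (x Io.a + ∑ j ∈ B Io, x j) := by
  rw [deg_xhat, deg_eq_sum, sum_split Io]

/-- The letter-count excess `B_k = k + Σ_{j ∈ B} (b j − qf j · k)/p` of the fibre element over `R`. [folklore] -/
def Bk (b : σ → ℕ) (k : ℕ) : ℕ := k + ∑ j ∈ B Io, (b j - Io.qf j * k) / Io.p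

/-- (F4) The degree along the fibre: `deg (Lof x k) = R + B_k`. [folklore] -/
theorem deg_Lof_eq (x : σ →₀ ℕ) (k : ℕ) : deg (Lof Io x k) = deg (xhat Io x) + Bk Io x k := by
  rw [deg_xhat, deg_eq_sum, sum_split Io, Lof_a]
  have h1 : ∑ j ∈ rest Io, (Lof Io x k) j = ∑ j ∈ rest Io, x j :=
    Finset.sum_congr rfl fun j hj => Lof_rest Io x k hj
  have h2 : ∑ j ∈ B Io, (Lof Io x k) j = ∑ j ∈ B Io, (x j - Io.qf j * k) / Io.p :=
    Finset.sum_congr rfl fun j hj => Lof_B Io x k hj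
  rw [h1, h2]; unfold Bk; ring

/-- `B_k ≤ Σ_{j ∈ B} b j` for admissible `k`. [folklore] -/
theorem Bk_le {b : σ → ℕ} {k : ℕ} (hk : Adm Io b k) : Bk Io b k ≤ ∑ j ∈ B Io, b j := by
  unfold Bk
  have hterm : ∀ j ∈ B Io, (b j - Io.qf j * k) / Io.p + Io.qf j * k ≤ b j := fun j hj => by
    have := (hk j hj).1
    have d : (b j - Io.qf j * k) / Io.p ≤ b j - Io.qf j * k := Nat.div_le_self _ _
    omega
  have hsum : ∑ j ∈ B Io, (b j - Io.qf j * k) / Io.p + ∑ j ∈ B Io, Io.qf j * k ≤ ∑ j ∈ B Io, b j := by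
    rw [← Finset.sum_add_distrib]; exact Finset.sum_le_sum hterm
  have hk' : k ≤ ∑ j ∈ B Io, Io.qf j * k := by
    obtain ⟨j₀, hj₀⟩ := B_nonempty Io
    have h1 : 1 ≤ Io.qf j₀ := Nat.one_le_iff_ne_zero.mpr ((mem_B Io j₀).1 hj₀)
    calc k ≤ Io.qf j₀ * k := Nat.le_mul_of_pos_left k h1
      _ ≤ ∑ j ∈ B Io, Io.qf j * k := Finset.single_le_sum (f := fun j => Io.qf j * k) (fun j _ => Nat.zero_le _) hj₀
  omega

/-- `1 ≤ B_k` for admissible `k` on a nonzero slice. [folklore] -/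
theorem Bk_pos {b : σ → ℕ} {k : ℕ} (hk : Adm Io b k) (hb : 1 ≤ ∑ j ∈ B Io, b j) : 1 ≤ Bk Io b k := by
  unfold Bk
  rcases Nat.eq_zero_or_pos k with hk0 | hk0
  · subst hk0
    obtain ⟨j₀, hj₀, hbj⟩ : ∃ j ∈ B Io, 1 ≤ b j := by
      by_contra hcon
      push Not at hcon
      have : ∑ j ∈ B Io, b j = 0 := Finset.sum_eq_zero fun j hj => by have := hcon j hj; omega
      omega
    have hd := (hk j₀ hj₀).2
    simp only [mul_zero, Nat.sub_zero] at hd ⊢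
    have h1 : 1 ≤ b j₀ / Io.p := Nat.div_pos (Nat.le_of_dvd hbj hd) Io.hp
    calc 1 ≤ b j₀ / Io.p := h1
      _ ≤ ∑ j ∈ B Io, b j / Io.p := Finset.single_le_sum (f := fun j => b j / Io.p) (fun j _ => Nat.zero_le _) hj₀
      _ = 0 + ∑ j ∈ B Io, b j / Io.p := (zero_add _).symm
  · omega

end R8
end Summit.ValiantsHypothesis.ValiantsHypothesis.Theorems.NewtonUnitEquations.TwoProducts.PermutationType

end
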